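import Mathlib
import Literature.Combinatorics.Additive.TripleProductProperty
import Summits.MatrixMultiplication.MatrixMultiplication.Theorems.SnSubsetDichotomyThresholdSubsetTriplesStubCayleyDeletion
import Summits.MatrixMultiplication.MatrixMultiplication.Theorems.SnSubsetDichotomyThresholdSubsetTriplesStubTppOfTwistFree

/-!
# `SnSubsetDichotomy.ThresholdSubsetTriples`, line `SketchIdeator2` — stub `stub_twistFree_of_blocked`, general-group form and assembled chain

Crux `stmt-MatrixMultiplication-10882`
(`Summit.MatrixMultiplication.MatrixMultiplication.Theses.SnSubsetDichotomy.ThresholdSubsetTriples`), line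
`SketchIdeator2` (ℤ/3-triality: TPP triples of the shape `(X, τXτ⁻¹, τ²Xτ⁻²)` with `τ³ = 1`), registered stub
`stub_twistFree_of_blocked`: if every solution in `K⁶` of the *twisted corner equation*
`x₁x₁'⁻¹ τ (x₂x₂'⁻¹) τ (x₃x₃'⁻¹) τ = 1` is trivial (`xᵢ = xᵢ'`) or has a non-trivial quotient `xᵢxᵢ'⁻¹` in a
blocking set `B` ("`K` is a `B`-blocked host"), and `X ⊆ K` avoids `B` as a right quotient
(`x x'⁻¹ ∈ B ⇒ x = x'` on `X`), then every solution in `X⁶` is trivial ("`X` is twisted-corner-free").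

This file proves the stub by REDUCTION AND ASSEMBLY, in an arbitrary group `G` (the two landed proofs,
`ThresholdSubsetTriples.stub_twistFree_of_blocked` and `ThresholdSubsetTriples.TwistFreeOfBlockedK12.*`, are stated for
`Equiv.Perm (Fin n)` only):

* `blocked_mono` — being a `B`-blocked host is inherited by subsets (`X ⊆ K`);
* `twistFree_of_blocked_self` — the case `K = X`: a `B`-blocked set avoiding `B` as a quotient is twisted-corner-free
  (each blocked alternative `xᵢxᵢ'⁻¹ ∈ B ∧ xᵢ ≠ xᵢ'` contradicts avoidance at `xᵢ, xᵢ' ∈ X`);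
* `twistFree_of_blocked` — the general-group form of the stub, the composite of the two;
* `exists_tpp_triple_of_blocked` — the whole deletion chain of line `SketchIdeator2` in a general group, ASSEMBLED from
  the landed lemmas of this crux `CayleyDeletion.exists_subset_avoiding_quotients` (stub `stub_cayleyDeletion`) and
  `TppOfTwistFree.tpp_of_twist` (stub `stub_tpp_of_twistFree`) with `twistFree_of_blocked` in between: a `B`-blocked
  host `K` for `τ` with `τ³ = 1` contains `X` with `(X, τXτ⁻¹, τ²Xτ⁻²)` a TPP triple
  (`Literature.Combinatorics.Additive.TripleProductProperty`) and `|K| ≤ (2|B| + 1)|X|`;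
* `stub_twistFree_of_blocked` — the registered signature, verbatim, as the specialisation of `twistFree_of_blocked` to
  `G = Equiv.Perm (Fin n)`.

Everything lives in the sub-namespace `TwistFreeOfBlockedK15`; nothing here restates or imports the two landed proofs of
the same stub.  Deliberately NOT here: the host design (`stub_blockedHosts`, open), the numeric threshold step
(`stub_cubeThreshold`), or anything about the other lines of the crux.
-/

namespace Summit.MatrixMultiplication.MatrixMultiplication.Theorems.ThresholdSubsetTriples.TwistFreeOfBlockedK15

open Literature.Combinatorics.Additive

variable {G : Type*} [Group G]

/-- **Restriction.**  If every twisted corner `x₁x₁'⁻¹ τ (x₂x₂'⁻¹) τ (x₃x₃'⁻¹) τ = 1` with all six variables in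
`K` is trivial or has a non-trivial quotient `xᵢxᵢ'⁻¹ ∈ B`, then the same holds with all six variables in any
`X ⊆ K` (the property is a universal statement over `K⁶`, hence inherited by `X⁶ ⊆ K⁶`). [folklore] -/
theorem blocked_mono {τ : G} {K B X : Finset G} (hXK : X ⊆ K)
    (hK : ∀ x₁ ∈ K, ∀ x₁' ∈ K, ∀ x₂ ∈ K, ∀ x₂' ∈ K, ∀ x₃ ∈ K, ∀ x₃' ∈ K,
      x₁ * x₁'⁻¹ * τ * (x₂ * x₂'⁻¹) * τ * (x₃ * x₃'⁻¹) * τ = 1 →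
        (x₁ = x₁' ∧ x₂ = x₂' ∧ x₃ = x₃') ∨ (x₁ * x₁'⁻¹ ∈ B ∧ x₁ ≠ x₁') ∨
          (x₂ * x₂'⁻¹ ∈ B ∧ x₂ ≠ x₂') ∨ (x₃ * x₃'⁻¹ ∈ B ∧ x₃ ≠ x₃')) :
    ∀ x₁ ∈ X, ∀ x₁' ∈ X, ∀ x₂ ∈ X, ∀ x₂' ∈ X, ∀ x₃ ∈ X, ∀ x₃' ∈ X,
      x₁ * x₁'⁻¹ * τ * (x₂ * x₂'⁻¹) * τ * (x₃ * x₃'⁻¹) * τ = 1 →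
        (x₁ = x₁' ∧ x₂ = x₂' ∧ x₃ = x₃') ∨ (x₁ * x₁'⁻¹ ∈ B ∧ x₁ ≠ x₁') ∨
          (x₂ * x₂'⁻¹ ∈ B ∧ x₂ ≠ x₂') ∨ (x₃ * x₃'⁻¹ ∈ B ∧ x₃ ≠ x₃') :=
  fun x₁ h₁ x₁' h₁' x₂ h₂ x₂' h₂' x₃ h₃ x₃' h₃' =>
    hK x₁ (hXK h₁) x₁' (hXK h₁') x₂ (hXK h₂) x₂' (hXK h₂') x₃ (hXK h₃) x₃' (hXK h₃')

/-- **The case `K = X`.**  If every twisted corner of `X` itself is trivial or has a non-trivial quotient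
`xᵢxᵢ'⁻¹ ∈ B`, and `X` avoids `B` as a right quotient (`x x'⁻¹ ∈ B ⇒ x = x'` for `x, x' ∈ X`), then every twisted
corner of `X` is trivial: a blocked alternative `xᵢxᵢ'⁻¹ ∈ B ∧ xᵢ ≠ xᵢ'` contradicts avoidance at
`xᵢ, xᵢ' ∈ X`. [folklore] -/
theorem twistFree_of_blocked_self {τ : G} {B X : Finset G}
    (hX : ∀ x₁ ∈ X, ∀ x₁' ∈ X, ∀ x₂ ∈ X, ∀ x₂' ∈ X, ∀ x₃ ∈ X, ∀ x₃' ∈ X,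
      x₁ * x₁'⁻¹ * τ * (x₂ * x₂'⁻¹) * τ * (x₃ * x₃'⁻¹) * τ = 1 →
        (x₁ = x₁' ∧ x₂ = x₂' ∧ x₃ = x₃') ∨ (x₁ * x₁'⁻¹ ∈ B ∧ x₁ ≠ x₁') ∨
          (x₂ * x₂'⁻¹ ∈ B ∧ x₂ ≠ x₂') ∨ (x₃ * x₃'⁻¹ ∈ B ∧ x₃ ≠ x₃'))
    (hA : ∀ x ∈ X, ∀ x' ∈ X, x * x'⁻¹ ∈ B → x = x') :
    ∀ x₁ ∈ X, ∀ x₁' ∈ X, ∀ x₂ ∈ X, ∀ x₂' ∈ X, ∀ x₃ ∈ X, ∀ x₃' ∈ X,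
      x₁ * x₁'⁻¹ * τ * (x₂ * x₂'⁻¹) * τ * (x₃ * x₃'⁻¹) * τ = 1 → x₁ = x₁' ∧ x₂ = x₂' ∧ x₃ = x₃' := by
  intro x₁ h₁ x₁' h₁' x₂ h₂ x₂' h₂' x₃ h₃ x₃' h₃' heq
  rcases hX x₁ h₁ x₁' h₁' x₂ h₂ x₂' h₂' x₃ h₃ x₃' h₃' heq with h | ⟨hb, hne⟩ | ⟨hb, hne⟩ | ⟨hb, hne⟩
  · exact h
  · exact absurd (hA x₁ h₁ x₁' h₁' hb) hne
  · exact absurd (hA x₂ h₂ x₂' h₂' hb) hne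
  · exact absurd (hA x₃ h₃ x₃' h₃' hb) hne

/-- **Blocked host ⇒ twisted-corner-free sub-code, in any group** (general-group form of the registered stub
`stub_twistFree_of_blocked`).  If every twisted corner `x₁x₁'⁻¹ τ (x₂x₂'⁻¹) τ (x₃x₃'⁻¹) τ = 1` of the host `K`
is trivial or has a non-trivial quotient in `B`, and `X ⊆ K` avoids `B` as a right quotient, then `X` has only
trivial twisted corners.  Proof: restrict the host hypothesis to `X` (`blocked_mono`) and conclude in the case
`K = X` (`twistFree_of_blocked_self`). [folklore] -/
theorem twistFree_of_blocked (τ : G) (K B X : Finset G) (hXK : X ⊆ K)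
    (hK : ∀ x₁ ∈ K, ∀ x₁' ∈ K, ∀ x₂ ∈ K, ∀ x₂' ∈ K, ∀ x₃ ∈ K, ∀ x₃' ∈ K,
      x₁ * x₁'⁻¹ * τ * (x₂ * x₂'⁻¹) * τ * (x₃ * x₃'⁻¹) * τ = 1 →
        (x₁ = x₁' ∧ x₂ = x₂' ∧ x₃ = x₃') ∨ (x₁ * x₁'⁻¹ ∈ B ∧ x₁ ≠ x₁') ∨
          (x₂ * x₂'⁻¹ ∈ B ∧ x₂ ≠ x₂') ∨ (x₃ * x₃'⁻¹ ∈ B ∧ x₃ ≠ x₃'))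
    (hA : ∀ x ∈ X, ∀ x' ∈ X, x * x'⁻¹ ∈ B → x = x') :
    ∀ x₁ ∈ X, ∀ x₁' ∈ X, ∀ x₂ ∈ X, ∀ x₂' ∈ X, ∀ x₃ ∈ X, ∀ x₃' ∈ X,
      x₁ * x₁'⁻¹ * τ * (x₂ * x₂'⁻¹) * τ * (x₃ * x₃'⁻¹) * τ = 1 → x₁ = x₁' ∧ x₂ = x₂' ∧ x₃ = x₃' :=
  twistFree_of_blocked_self (blocked_mono hXK hK) hA

/-- **The deletion chain of line `SketchIdeator2`, assembled in a general group.**  Let `τ³ = 1` and let `K` be a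
`B`-blocked host for `τ` (every twisted corner of `K` is trivial or has a non-trivial quotient in `B`).  Then there is
`X ⊆ K` such that `(X, τXτ⁻¹, τ²Xτ⁻²)` has the triple product property and `|K| ≤ (2|B| + 1)·|X|`.
Assembly of the landed lemmas of this crux: Cayley-graph deletion `CayleyDeletion.exists_subset_avoiding_quotients`
gives `X ⊆ K` avoiding `B` as a quotient with the cardinality bound, `twistFree_of_blocked` makes `X`
twisted-corner-free, and the triality lever `TppOfTwistFree.tpp_of_twist` turns that into the TPP of the twisted
triple. [folklore] -/
theorem exists_tpp_triple_of_blocked [DecidableEq G] (τ : G) (hτ : τ ^ 3 = 1) (K B : Finset G)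
    (hK : ∀ x₁ ∈ K, ∀ x₁' ∈ K, ∀ x₂ ∈ K, ∀ x₂' ∈ K, ∀ x₃ ∈ K, ∀ x₃' ∈ K,
      x₁ * x₁'⁻¹ * τ * (x₂ * x₂'⁻¹) * τ * (x₃ * x₃'⁻¹) * τ = 1 →
        (x₁ = x₁' ∧ x₂ = x₂' ∧ x₃ = x₃') ∨ (x₁ * x₁'⁻¹ ∈ B ∧ x₁ ≠ x₁') ∨
          (x₂ * x₂'⁻¹ ∈ B ∧ x₂ ≠ x₂') ∨ (x₃ * x₃'⁻¹ ∈ B ∧ x₃ ≠ x₃')) :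
    ∃ X ⊆ K, TripleProductProperty X (X.image (fun x => τ * x * τ⁻¹))
        (X.image (fun x => τ ^ 2 * x * (τ ^ 2)⁻¹)) ∧ K.card ≤ (2 * B.card + 1) * X.card := by
  obtain ⟨X, hXK, hA, hcard⟩ := CayleyDeletion.exists_subset_avoiding_quotients K B
  exact ⟨X, hXK, TppOfTwistFree.tpp_of_twist X τ hτ (twistFree_of_blocked τ K B X hXK hK hA), hcard⟩

/-- **Stub `stub_twistFree_of_blocked` — blocked host ⇒ twisted-corner-free sub-code** (registered stub of line
`SketchIdeator2`, crux `SnSubsetDichotomy.ThresholdSubsetTriples`, stmt-MatrixMultiplication-10882; reduction form).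
If every solution in `K⁶` of the twisted corner equation `x₁x₁'⁻¹ τ (x₂x₂'⁻¹) τ (x₃x₃'⁻¹) τ = 1` in `S_n` is trivial
or has a non-trivial quotient `xᵢxᵢ'⁻¹ ∈ B`, and `X ⊆ K` avoids `B` as a quotient, then every solution in `X⁶` is
trivial: the specialisation of the general-group `twistFree_of_blocked` to `G = Equiv.Perm (Fin n)`. [folklore] -/
theorem stub_twistFree_of_blocked : ∀ (n : ℕ) (τ : Equiv.Perm (Fin n)) (K B X : Finset (Equiv.Perm (Fin n))), X ⊆ K → (∀ x₁ ∈ K, ∀ x₁' ∈ K, ∀ x₂ ∈ K, ∀ x₂' ∈ K, ∀ x₃ ∈ K, ∀ x₃' ∈ K, x₁ * x₁'⁻¹ * τ * (x₂ * x₂'⁻¹) * τ * (x₃ * x₃'⁻¹) * τ = 1 → (x₁ = x₁' ∧ x₂ = x₂' ∧ x₃ = x₃') ∨ (x₁ * x₁'⁻¹ ∈ B ∧ x₁ ≠ x₁') ∨ (x₂ * x₂'⁻¹ ∈ B ∧ x₂ ≠ x₂') ∨ (x₃ * x₃'⁻¹ ∈ B ∧ x₃ ≠ x₃')) → (∀ x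 ∈ X, ∀ x' ∈ X, x * x'⁻¹ ∈ B → x = x') → ∀ x₁ ∈ X, ∀ x₁' ∈ X, ∀ x₂ ∈ X, ∀ x₂' ∈ X, ∀ x₃ ∈ X, ∀ x₃' ∈ X, x₁ * x₁'⁻¹ * τ * (x₂ * x₂'⁻¹) * τ * (x₃ * x₃'⁻¹) * τ = 1 → x₁ = x₁' ∧ x₂ = x₂' ∧ x₃ = x₃' :=
  fun _ τ K B X => twistFree_of_blocked τ K B X

end Summit.MatrixMultiplication.MatrixMultiplication.Theorems.ThresholdSubsetTriples.TwistFreeOfBlockedK15
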